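import Literature.NumberTheory.EllipticCurves.TunnellFormsCuspidalProofs
import Literature.NumberTheory.EllipticCurves.TunnellThmTwoHeckeProofs
import Literature.NumberTheory.EllipticCurves.HalfIntegralWeightHeckeCommuteProofs
import Mathlib.Tactic.NormNum.LegendreSymbol
import HarnessLib

/-!
# Tunnell 1983, Theorem 2 (trivial character): the Hecke side —
# "`g(θ₂ - θ₈)`, `g θ₈` are eigenforms for all `T(p²)`", and the reduction of
# `Tunnell1983_thm2_triv` to the dimension count and the Shimura–Niwa correspondence

Trivial-character twin of `TunnellThmTwoHeckeProofs` (which treats `g θ₄, g θ₁₆`, character `χ₂`),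
for the named fact `Tunnell1983_thm2_triv` of `TunnellHalfIntegralForms` (Tunnell 1983, Thm 2:
`g θ₂, g θ₈ ∈ S_{3/2}(128, 1, φ)`). Tunnell's proof (p. 327 l. 13 – p. 328 l. 6) combines
(a) the basis `{g θ₂, g θ₈, g θ₃₂}` of `S_{3/2}(128, 1)` — membership is now a theorem
(`tunnellForm_two/eight/thirtytwo_mem_halfIntCuspForms`, `TunnellFormsCuspidalProofs`), spanning
is the dimension formula of Cohen–Oesterlé [3]; (b) "hence `g(θ₂ - θ₈)`, `g θ₈` are eigenforms for
all `T(p²)`" from the exponents modulo `8` and — for the class `n ≡ 1 (mod 8)`, which carries both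
`g θ₈` and `∑ ψ(m) m q^{m²} = 2 g θ₃₂ - g θ₈` — the self-adjointness of `T(p²)` for the Petersson
product; (c) the identification of the eigenvalues with `a_p(E)` by Shimura's theorem [18], Niwa
[11] and [4, Table 3] ("Consideration of `T(3²)` and `T(5²)` shows that `φ₁ = φ₂ = φ`").

Here **(b) is PROVED given the spanning half of (a)**, with the Petersson product replaced by the
commutativity `T(p²) T(3²) = T(3²) T(p²)` (`heckeTSq_comm`, `HalfIntegralWeightHeckeCommuteProofs`),
and the fact is **reduced to exactly (a)-spanning and (c)**:

* `heckeTSq_eight_eq_lincomb`, `heckeTSq_thirtytwo_eq_lincomb` — given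
  (CO) `S_{3/2}(128, 1) ⊆ span {g θ₂, g θ₈, g θ₃₂}`, for odd primes `p` the images `T(p²)(g θ₈)`,
  `T(p²)(g θ₃₂)` (in `S_{3/2}(128, 1)` by Shimura's Thm 1.7, `Shimura1973_heckeTSq_mem_holds`) are
  `y g θ₈ + z g θ₃₂` on `q`-expansions (no `g θ₂`-component: coefficient of `q³`, `a(3) = 2`);
* `heckeTSq_three_eight`, `heckeTSq_three_thirtytwo` — **the matrix of `T(3²)` on the class-`1`
  part**: `T(9)(g θ₈) = 0` and `T(9)(g θ₃₂) = 2 g θ₈ - 4 g θ₃₂` (from `d₈(9) = 1`, `d₈(81) = -3`,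
  `d₃₂(9) = -1`, `d₃₂(81) = 3`, `(-1/3) = -1`), i.e. `T(9) h = -4 h` for `h = 2 g θ₃₂ - g θ₈` ("its
  eigenvalue for `T(3²)` is `-4`", p. 327);
* `heckeTSq_tunnellForm_eight_eq_smul` — **`g θ₈` is an eigenform of every `T(p²)`**, `p` odd:
  `0 = T(p²)T(9)(g θ₈) = T(9)T(p²)(g θ₈) = z (2 g θ₈ - 4 g θ₃₂)` forces `z = 0`;
  `heckeTSq_two_sub_eight_eq_smul` — **`g(θ₂ - θ₈)` is an eigenform** (its image lives on
  `n ≡ 3 (mod 8)`, where only `g θ₂` has coefficients: `x + y + z = 0` at `q¹`, `x + y - z = 0` at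
  `q⁹`); `T(4)` kills both (`heckeTSq_two_*`);
* `heckeTSq_tunnellForm_eight_three_one/five_one`, `heckeTSq_two_sub_eight_three_three/five_three`
  — "consideration of `T(3²)`, `T(5²)`": the eigenvalues are `λ₃ = 0 = a₃(E)`, `λ₅ = -2 = a₅(E)`
  for both forms (`d₈(25) = -3`, `d₂(27) = 0`, `d₂(75) = -2`, `(-1/5) = 1`, `(-3/5) = -1`);
* `Tunnell1983_thm2_triv_of_span_of_shimuraNiwa` — **Theorem 2 (trivial character) from (CO)
  and (SN)**: if `S_{3/2}(128, 1) ⊆ span {g θ₂, g θ₈, g θ₃₂}` and every nonzero common eigenform of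
  the `T(p²)` in `S_{3/2}(128, 1)` with `λ₃ = 0`, `λ₅ = -2` has `λ_p = a_p(E)` for all odd `p`, then
  `Tunnell1983_thm2_triv`; `linearIndependent_tunnellForm_triv`,
  `halfIntCuspForms_le_span_of_finrank_le`, `Tunnell1983_thm2_triv_of_finrank_le_of_shimuraNiwa` —
  the same with (CO) in its printed form `dim S_{3/2}(128, 1) ≤ 3` (`g θ₂, g θ₈, g θ₃₂` are linearly
  independent: coefficients of `q³, q¹, q⁹`).

No definitions and no new named facts (D-0026); the two hypotheses are the published inputs [3]
and [18]+[11]+[4] exactly as they enter on pp. 327–328, stated inline.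

## References

* J. B. Tunnell, *A classical Diophantine problem and modular forms of weight 3/2*, Invent. Math.
  72 (1983) 323–334: p. 325 (`a_p(E)`), p. 327 l. 13 – p. 328 l. 6 (proof of Theorem 2).
  [Tunnell1983Congruent]
* G. Shimura, *On modular forms of half integral weight*, Ann. of Math. 97 (1973) 440–481, Thm 1.7,
  §1 (commutativity of the Hecke algebra), Main Theorem. [Shimura1973HalfIntegral]
* S. Niwa, Nagoya Math. J. 56 (1975) 147–161; H. Cohen, J. Oesterlé, LNM 627 (1977) 69–78;
  B. Birch, W. Kuyk (eds.), *Modular functions of one variable IV*, LNM 476, Table 3 (Tunnell's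
  [11], [3], [4]). Not held; used only for the shape of the two hypotheses.
-/

noncomputable section

open scoped MatrixGroups Manifold NumberTheorySymbols

open UpperHalfPlane Complex Function Literature.NumberTheory.EllipticCurves.ModularForms

namespace Literature.NumberTheory.EllipticCurves.Tunnell1983

/-! ### `q`-expansions of `x g θ₂ + y g θ₈ + z g θ₃₂` and of `g θ₂ - g θ₈` -/

/-- The `q`-series of a linear combination `x g θ₂ + y g θ₈ + z g θ₃₂`. [folklore] -/
theorem hasSum_lincomb_triv (x y z : ℂ) (τ : ℍ) :
    HasSum (fun N : ℕ ↦ (x * formCoeff 2 N + y * formCoeff 8 N + z * formCoeff 32 N) *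
        Periodic.qParam 1 τ ^ N)
      ((x • tunnellForm 2 + y • tunnellForm 8 + z • tunnellForm 32) τ) := by
  have h := ((hasSum_tunnellForm two_pos τ).mul_left x).add
    (((hasSum_tunnellForm (by norm_num : 0 < 8) τ).mul_left y).add
      ((hasSum_tunnellForm (by norm_num : 0 < 32) τ).mul_left z))
  have hf : (fun N : ℕ ↦ (x * formCoeff 2 N + y * formCoeff 8 N + z * formCoeff 32 N) *
        Periodic.qParam 1 τ ^ N) =
      fun N : ℕ ↦ x * ((formCoeff 2 N : ℂ) * Periodic.qParam 1 τ ^ N) +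
        (y * ((formCoeff 8 N : ℂ) * Periodic.qParam 1 τ ^ N) +
          z * ((formCoeff 32 N : ℂ) * Periodic.qParam 1 τ ^ N)) := by
    funext N
    ring
  have hv : (x • tunnellForm 2 + y • tunnellForm 8 + z • tunnellForm 32) τ =
      x * tunnellForm 2 τ + (y * tunnellForm 8 τ + z * tunnellForm 32 τ) := by
    change x • tunnellForm 2 τ + y • tunnellForm 8 τ + z • tunnellForm 32 τ = _
    simp only [smul_eq_mul]
    ring
  rw [hf, hv]
  exact h

/-- **The `q`-expansion of `x g θ₂ + y g θ₈ + z g θ₃₂` is `∑ (x d₂(N) + y d₈(N) + z d₃₂(N)) q^N`.**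
[folklore] -/
theorem qCoeffs_lincomb_triv (x y z : ℂ) :
    qCoeffs (x • tunnellForm 2 + y • tunnellForm 8 + z • tunnellForm 32) =
      fun N : ℕ ↦ x * formCoeff 2 N + y * formCoeff 8 N + z * formCoeff 32 N :=
  qCoeffs_eq_of_hasSum (hasSum_lincomb_triv x y z)

/-- The `q`-series of `g θ₂ - g θ₈ = g(θ₂ - θ₈)`. [folklore] -/
theorem hasSum_tunnellForm_two_sub_eight (τ : ℍ) :
    HasSum (fun N : ℕ ↦ ((formCoeff 2 N : ℂ) - formCoeff 8 N) * Periodic.qParam 1 τ ^ N)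
      ((tunnellForm 2 - tunnellForm 8) τ) := by
  have h := (hasSum_tunnellForm two_pos τ).sub (hasSum_tunnellForm (by norm_num : 0 < 8) τ)
  have hf : (fun N : ℕ ↦ ((formCoeff 2 N : ℂ) - formCoeff 8 N) * Periodic.qParam 1 τ ^ N) =
      fun N : ℕ ↦ (formCoeff 2 N : ℂ) * Periodic.qParam 1 τ ^ N -
        (formCoeff 8 N : ℂ) * Periodic.qParam 1 τ ^ N := by
    funext N
    ring
  rw [hf]
  exact h

/-- **The `q`-expansion of `g(θ₂ - θ₈)` is `∑ (d₂(N) - d₈(N)) q^N`.** [cite: Tunnell1983Congruent, p. 327] -/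
theorem qCoeffs_tunnellForm_two_sub_eight :
    qCoeffs (tunnellForm 2 - tunnellForm 8) = fun N : ℕ ↦ ((formCoeff 2 N : ℂ) - formCoeff 8 N) :=
  qCoeffs_eq_of_hasSum hasSum_tunnellForm_two_sub_eight

/-- `qCoeffs (g θ₂ - g θ₈) = qCoeffs (g θ₂) - qCoeffs (g θ₈)`. [folklore] -/
theorem qCoeffs_tunnellForm_two_sub_eight' :
    qCoeffs (tunnellForm 2 - tunnellForm 8) = qCoeffs (tunnellForm 2) - qCoeffs (tunnellForm 8) := by
  rw [qCoeffs_tunnellForm_two_sub_eight, qCoeffs_tunnellForm two_pos,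
    qCoeffs_tunnellForm (by norm_num : 0 < 8)]
  rfl

/-- **`g(θ₂ - θ₈)` lives on `n ≡ 3 (mod 8)`** ("has `qⁿ` appearing with nonzero coefficient only
when `n` is congruent to `3` modulo `8`", p. 327): `d₂(N) - d₈(N) = 0` unless `N ≡ 3 (mod 8)`.
[cite: Tunnell1983Congruent, proof of Thm 2, p. 327] -/
theorem formCoeff_two_sub_eight_eq_zero {N : ℕ} (hN : N % 8 ≠ 3) :
    (formCoeff 2 N : ℂ) - formCoeff 8 N = 0 := by
  by_cases h1 : N % 8 = 1
  · rw [formCoeff_eight_eq h1, sub_self]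
  · rw [formCoeff_two_eq_zero ⟨h1, hN⟩, formCoeff_eight_eq_zero h1, Int.cast_zero, sub_self]

/-- The coefficients of `g θ₈` vanish off the class `1` modulo `8`. [folklore] -/
theorem qCoeffs_eight_eq_zero {N : ℕ} (hN : N % 8 ≠ 1) : qCoeffs (tunnellForm 8) N = 0 := by
  rw [qCoeffs_tunnellForm (by norm_num : 0 < 8)]
  dsimp only
  rw [formCoeff_eight_eq_zero hN, Int.cast_zero]

/-- The coefficients of `g θ₃₂` vanish off the class `1` modulo `8`. [folklore] -/
theorem qCoeffs_thirtytwo_eq_zero {N : ℕ} (hN : N % 8 ≠ 1) : qCoeffs (tunnellForm 32) N = 0 := by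
  rw [qCoeffs_tunnellForm (by norm_num : 0 < 32)]
  dsimp only
  rw [formCoeff_thirtyTwo_eq_zero hN, Int.cast_zero]

/-- The coefficients of `g θ₂ - g θ₈` vanish off the class `3` modulo `8`. [folklore] -/
theorem qCoeffs_two_sub_eight_eq_zero {N : ℕ} (hN : N % 8 ≠ 3) :
    qCoeffs (tunnellForm 2 - tunnellForm 8) N = 0 := by
  rw [qCoeffs_tunnellForm_two_sub_eight]
  exact formCoeff_two_sub_eight_eq_zero hN

/-! ### Values of the coefficients `d_t(N)` used below (by `decide` on `gThetaCoeff`) -/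

/-- `d₂(1) = 1` (`a(1) = 1`). [cite: Tunnell1983Congruent, p. 327] -/
theorem formCoeff_two_one : (formCoeff 2 1 : ℂ) = 1 := by
  rw [formCoeff_eq_gThetaCoeff two_pos]
  exact_mod_cast (by decide +kernel : gThetaCoeff 2 1 = 1)

/-- `d₂(3) = 2` (`a(3) = 2`). [cite: Tunnell1983Congruent, p. 327] -/
theorem formCoeff_two_three : (formCoeff 2 3 : ℂ) = 2 := by
  rw [formCoeff_eq_gThetaCoeff two_pos]
  exact_mod_cast (by decide +kernel : gThetaCoeff 2 3 = 2)

/-- `d₂(9) = 1`. [cite: Tunnell1983Congruent, p. 327] -/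
theorem formCoeff_two_nine : (formCoeff 2 9 : ℂ) = 1 := by
  rw [formCoeff_eq_gThetaCoeff two_pos]
  exact_mod_cast (by decide +kernel : gThetaCoeff 2 9 = 1)

/-- `d₂(25) = -3`. [cite: Tunnell1983Congruent, p. 327] -/
theorem formCoeff_two_twentyfive : (formCoeff 2 25 : ℂ) = -3 := by
  rw [formCoeff_eq_gThetaCoeff two_pos]
  exact_mod_cast (by decide +kernel : gThetaCoeff 2 25 = -3)

/-- `d₂(27) = 0`. [folklore] -/
theorem formCoeff_two_twentyseven : (formCoeff 2 27 : ℂ) = 0 := by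
  rw [formCoeff_eq_gThetaCoeff two_pos]
  exact_mod_cast (by decide +kernel : gThetaCoeff 2 27 = 0)

/-- `d₂(75) = -2`. [folklore] -/
theorem formCoeff_two_seventyfive : (formCoeff 2 75 : ℂ) = -2 := by
  rw [formCoeff_eq_gThetaCoeff two_pos]
  exact_mod_cast (by decide +kernel : gThetaCoeff 2 75 = -2)

/-- `d₂(81) = -3`. [folklore] -/
theorem formCoeff_two_eightyone : (formCoeff 2 81 : ℂ) = -3 := by
  rw [formCoeff_eq_gThetaCoeff two_pos]
  exact_mod_cast (by decide +kernel : gThetaCoeff 2 81 = -3)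

/-- `d₈(1) = 1`. [cite: Tunnell1983Congruent, p. 327] -/
theorem formCoeff_eight_one : (formCoeff 8 1 : ℂ) = 1 := by
  rw [formCoeff_eight_eq (by norm_num), formCoeff_two_one]

/-- `d₈(3) = 0`. [folklore] -/
theorem formCoeff_eight_three : (formCoeff 8 3 : ℂ) = 0 := by
  rw [formCoeff_eight_eq_zero (by norm_num), Int.cast_zero]

/-- `d₈(9) = 1`. [cite: Tunnell1983Congruent, p. 327] -/
theorem formCoeff_eight_nine : (formCoeff 8 9 : ℂ) = 1 := by
  rw [formCoeff_eight_eq (by norm_num), formCoeff_two_nine]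

/-- `d₈(25) = -3`. [cite: Tunnell1983Congruent, p. 327] -/
theorem formCoeff_eight_twentyfive : (formCoeff 8 25 : ℂ) = -3 := by
  rw [formCoeff_eight_eq (by norm_num), formCoeff_two_twentyfive]

/-- `d₈(81) = -3`. [folklore] -/
theorem formCoeff_eight_eightyone : (formCoeff 8 81 : ℂ) = -3 := by
  rw [formCoeff_eight_eq (by norm_num), formCoeff_two_eightyone]

/-- `d₃₂(1) = 1`. [cite: Tunnell1983Congruent, p. 327] -/
theorem formCoeff_thirtytwo_one : (formCoeff 32 1 : ℂ) = 1 := by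
  rw [formCoeff_eq_gThetaCoeff (by norm_num)]
  exact_mod_cast (by decide +kernel : gThetaCoeff 32 1 = 1)

/-- `d₃₂(3) = 0`. [folklore] -/
theorem formCoeff_thirtytwo_three : (formCoeff 32 3 : ℂ) = 0 := by
  rw [formCoeff_thirtyTwo_eq_zero (by norm_num), Int.cast_zero]

/-- `d₃₂(9) = -1`. [cite: Tunnell1983Congruent, p. 327] -/
theorem formCoeff_thirtytwo_nine : (formCoeff 32 9 : ℂ) = -1 := by
  rw [formCoeff_eq_gThetaCoeff (by norm_num)]
  exact_mod_cast (by decide +kernel : gThetaCoeff 32 9 = -1)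

/-- `d₃₂(81) = 3`. [folklore] -/
theorem formCoeff_thirtytwo_eightyone : (formCoeff 32 81 : ℂ) = 3 := by
  rw [formCoeff_eq_gThetaCoeff (by norm_num)]
  exact_mod_cast (by decide +kernel : gThetaCoeff 32 81 = 3)

/-! ### The trivial character at `3`, `5`, `9`, `25` -/

/-- `1(m) = 1` for `m` prime to `128` (the trivial character modulo `128`). [folklore] -/
theorem trivChar_natCast {m : ℕ} (hm : m.Coprime 128) :
    (1 : DirichletCharacter ℂ 128) (m : ZMod 128) = 1 :=
  MulChar.one_apply ((ZMod.isUnit_iff_coprime m 128).mpr hm)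

/-- `1(3) = 1`. [folklore] -/
theorem trivChar_three : (1 : DirichletCharacter ℂ 128) (3 : ZMod 128) = 1 := by
  simpa using trivChar_natCast (m := 3) (by norm_num)

/-- `1(5) = 1`. [folklore] -/
theorem trivChar_five : (1 : DirichletCharacter ℂ 128) (5 : ZMod 128) = 1 := by
  simpa using trivChar_natCast (m := 5) (by norm_num)

/-- `1(9) = 1`. [folklore] -/
theorem trivChar_nine : (1 : DirichletCharacter ℂ 128) (9 : ZMod 128) = 1 := by
  simpa using trivChar_natCast (m := 9) (by norm_num)

/-- `1(25) = 1`. [folklore] -/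
theorem trivChar_twentyfive : (1 : DirichletCharacter ℂ 128) (25 : ZMod 128) = 1 := by
  simpa using trivChar_natCast (m := 25) (by norm_num)

/-- `1(3²) = 1`. [folklore] -/
theorem trivChar_three_sq : (1 : DirichletCharacter ℂ 128) ((3 : ZMod 128) ^ 2) = 1 := by
  rw [show ((3 : ZMod 128) ^ 2) = 9 by norm_num, trivChar_nine]

/-- `1(5²) = 1`. [folklore] -/
theorem trivChar_five_sq : (1 : DirichletCharacter ℂ 128) ((5 : ZMod 128) ^ 2) = 1 := by
  rw [show ((5 : ZMod 128) ^ 2) = 25 by norm_num, trivChar_twentyfive]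

/-! ### The images `T(p²)(g θ₈)`, `T(p²)(g θ₃₂)` inside the span (given the basis) -/

/-- **`T(p²)(g θ₃₂)` lives on `n ≡ 1 (mod 8)`** (`p` odd). [cite: Tunnell1983Congruent, proof of Thm 2, pp. 327–328] -/
theorem heckeTSq_qCoeffs_thirtytwo_eq_zero (χ : DirichletCharacter ℂ 128) {p : ℕ} (hp : Odd p)
    {n : ℕ} (hn : n % 8 ≠ 1) : heckeTSq 3 χ p (qCoeffs (tunnellForm 32)) n = 0 :=
  heckeTSq_apply_eq_zero_of_mod_eight 3 χ hp (fun _ hm ↦ qCoeffs_thirtytwo_eq_zero hm) hn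

section Span

variable (hCO : halfIntCuspForms 3 128 1 ≤
  Submodule.span ℂ {tunnellForm 2, tunnellForm 8, tunnellForm 32})
include hCO

/-- **Given the basis, `T(p²)(g θ₈) = y g θ₈ + z g θ₃₂` on `q`-expansions** (`p` an odd prime):
`T(p²)(g θ₈) ∈ S_{3/2}(128, 1)` (Shimura 1973, Thm 1.7, `Shimura1973_heckeTSq_mem_holds`, with
`g θ₈ ∈ S_{3/2}(128, 1)`, `tunnellForm_eight_mem_halfIntCuspForms`) is `x g θ₂ + y g θ₈ + z g θ₃₂`
by (CO), and lives on `n ≡ 1 (mod 8)`, so `2x = 0` (coefficient of `q³`; `a(3) = 2`).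
[cite: Tunnell1983Congruent, proof of Thm 2, pp. 327–328] -/
theorem heckeTSq_eight_eq_lincomb {p : ℕ} (hp : p.Prime) (hp2 : p ≠ 2) :
    ∃ y z : ℂ, heckeTSq 3 (1 : DirichletCharacter ℂ 128) p (qCoeffs (tunnellForm 8)) =
      fun N : ℕ ↦ y * formCoeff 8 N + z * formCoeff 32 N := by
  have hpo : Odd p := hp.odd_of_ne_two hp2
  obtain ⟨g, hgS, hg⟩ := (Shimura1973_heckeTSq_mem_holds 3 128 1 p ⟨1, rfl⟩ ⟨32, rfl⟩ hp).2 _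
    tunnellForm_eight_mem_halfIntCuspForms
  obtain ⟨x, y, z, rfl⟩ := Submodule.mem_span_triple.mp (hCO hgS)
  rw [qCoeffs_lincomb_triv] at hg
  have h3 : x * (formCoeff 2 3 : ℂ) + y * formCoeff 8 3 + z * formCoeff 32 3 =
      heckeTSq 3 (1 : DirichletCharacter ℂ 128) p (qCoeffs (tunnellForm 8)) 3 := congr_fun hg 3
  rw [heckeTSq_qCoeffs_tunnellForm_eight_eq_zero (1 : DirichletCharacter ℂ 128) hpo (by norm_num), formCoeff_two_three,
    formCoeff_eight_three, formCoeff_thirtytwo_three] at h3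
  have hx : x = 0 := by linear_combination h3 / 2
  subst hx
  refine ⟨y, z, ?_⟩
  rw [← hg]
  funext N
  ring

/-- **Given the basis, `T(p²)(g θ₃₂) = y g θ₈ + z g θ₃₂` on `q`-expansions** (`p` an odd prime),
likewise (`g θ₃₂ ∈ S_{3/2}(128, 1)`, `tunnellForm_thirtytwo_mem_halfIntCuspForms`, lives on
`n ≡ 1 (mod 8)`). [cite: Tunnell1983Congruent, proof of Thm 2, pp. 327–328] -/
theorem heckeTSq_thirtytwo_eq_lincomb {p : ℕ} (hp : p.Prime) (hp2 : p ≠ 2) :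
    ∃ y z : ℂ, heckeTSq 3 (1 : DirichletCharacter ℂ 128) p (qCoeffs (tunnellForm 32)) =
      fun N : ℕ ↦ y * formCoeff 8 N + z * formCoeff 32 N := by
  have hpo : Odd p := hp.odd_of_ne_two hp2
  obtain ⟨g, hgS, hg⟩ := (Shimura1973_heckeTSq_mem_holds 3 128 1 p ⟨1, rfl⟩ ⟨32, rfl⟩ hp).2 _
    tunnellForm_thirtytwo_mem_halfIntCuspForms
  obtain ⟨x, y, z, rfl⟩ := Submodule.mem_span_triple.mp (hCO hgS)
  rw [qCoeffs_lincomb_triv] at hg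
  have h3 : x * (formCoeff 2 3 : ℂ) + y * formCoeff 8 3 + z * formCoeff 32 3 =
      heckeTSq 3 (1 : DirichletCharacter ℂ 128) p (qCoeffs (tunnellForm 32)) 3 := congr_fun hg 3
  rw [heckeTSq_qCoeffs_thirtytwo_eq_zero (1 : DirichletCharacter ℂ 128) hpo (by norm_num), formCoeff_two_three,
    formCoeff_eight_three, formCoeff_thirtytwo_three] at h3
  have hx : x = 0 := by linear_combination h3 / 2
  subst hx
  refine ⟨y, z, ?_⟩
  rw [← hg]
  funext N
  ring

/-! ### `T(3²)` on the class-`1` part: `T(9)(g θ₈) = 0`, `T(9)(g θ₃₂) = 2 g θ₈ - 4 g θ₃₂` -/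

/-- **`T(3²)(g θ₈) = 0` given the basis** ("its eigenvalue is `a₃(E) = 0`"): the image
`y g θ₈ + z g θ₃₂` has coefficient `y + z = d₈(9) + (-1/3) d₈(1) = 0` at `q¹` and
`y - z = d₈(81) + 3 d₈(1) = 0` at `q⁹`. [cite: Tunnell1983Congruent, proof of Thm 2, p. 327] -/
theorem heckeTSq_three_eight :
    heckeTSq 3 (1 : DirichletCharacter ℂ 128) 3 (qCoeffs (tunnellForm 8)) = 0 := by
  obtain ⟨y, z, h⟩ := heckeTSq_eight_eq_lincomb hCO Nat.prime_three (by norm_num)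
  have h1 := congr_fun h 1
  have h9 := congr_fun h 9
  rw [heckeTSq_three_apply, qCoeffs_tunnellForm (by norm_num : 0 < 8)] at h1 h9
  dsimp only at h1 h9
  norm_num [formCoeff_eight_nine, formCoeff_eight_one, formCoeff_eight_eightyone,
    formCoeff_thirtytwo_one, formCoeff_thirtytwo_nine, trivChar_three, trivChar_three_sq, trivChar_nine,
    Nat.dvd_one] at h1 h9
  have hy : y = 0 := by linear_combination (-(h1) - h9) / 2
  have hz : z = 0 := by linear_combination (h9 - h1) / 2
  rw [h, hy, hz]
  funext N
  simp

/-- **`T(3²)(g θ₃₂) = 2 g θ₈ - 4 g θ₃₂` on `q`-expansions, given the basis**: the image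
`y g θ₈ + z g θ₃₂` has `y + z = d₃₂(9) - d₃₂(1) = -2` (`q¹`) and `y - z = d₃₂(81) + 3 d₃₂(1) = 6`
(`q⁹`). Equivalently `T(3²) h = -4 h` for `h = 2 g θ₃₂ - g θ₈ = ∑ χ₋₄(m) m q^{m²}` ("its eigenvalue
for `T(3²)` is `-4`", p. 327). [cite: Tunnell1983Congruent, proof of Thm 2, p. 327] -/
theorem heckeTSq_three_thirtytwo :
    heckeTSq 3 (1 : DirichletCharacter ℂ 128) 3 (qCoeffs (tunnellForm 32)) =
      fun N : ℕ ↦ 2 * (formCoeff 8 N : ℂ) - 4 * formCoeff 32 N := by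
  obtain ⟨y, z, h⟩ := heckeTSq_thirtytwo_eq_lincomb hCO Nat.prime_three (by norm_num)
  have h1 := congr_fun h 1
  have h9 := congr_fun h 9
  rw [heckeTSq_three_apply, qCoeffs_tunnellForm (by norm_num : 0 < 32)] at h1 h9
  dsimp only at h1 h9
  norm_num [formCoeff_eight_nine, formCoeff_eight_one, formCoeff_thirtytwo_eightyone,
    formCoeff_thirtytwo_one, formCoeff_thirtytwo_nine, trivChar_three, trivChar_three_sq, trivChar_nine,
    Nat.dvd_one] at h1 h9
  have hy : y = 2 := by linear_combination (-(h1) - h9) / 2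
  have hz : z = -4 := by linear_combination (h9 - h1) / 2
  rw [h, hy, hz]
  funext N
  ring

/-! ### "Hence eigenforms for all `T(p²)`" (Tunnell p. 327, given the basis) -/

/-- **Tunnell 1983, proof of Theorem 2 — `g θ₈` is an eigenform of every `T(p²)`, `p` odd, given the
basis**, the eigenvalue being the coefficient of `q¹` in `T(p²)(g θ₈)`. The image is
`y g θ₈ + z g θ₃₂` (`heckeTSq_eight_eq_lincomb`); to see `z = 0` Tunnell uses that `T(p²)` is
self-adjoint and `g θ₈ ⊥ ∑ χ₋₄(m) m q^{m²}`; here instead: `T(p²)` commutes with `T(3²)`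
(`heckeTSq_comm`), `T(3²)(g θ₈) = 0` and `T(3²)(g θ₃₂) = 2 g θ₈ - 4 g θ₃₂`, so
`0 = T(p²) T(3²)(g θ₈) = T(3²) T(p²)(g θ₈) = z (2 g θ₈ - 4 g θ₃₂)`, whose coefficient of `q¹` is
`-2z`. [cite: Tunnell1983Congruent, proof of Thm 2, pp. 327–328] -/
theorem heckeTSq_tunnellForm_eight_eq_smul {p : ℕ} (hp : p.Prime) (hp2 : p ≠ 2) :
    heckeTSq 3 (1 : DirichletCharacter ℂ 128) p (qCoeffs (tunnellForm 8)) =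
      heckeTSq 3 (1 : DirichletCharacter ℂ 128) p (qCoeffs (tunnellForm 8)) 1 • qCoeffs (tunnellForm 8) := by
  obtain ⟨y, z, h⟩ := heckeTSq_eight_eq_lincomb hCO hp hp2
  have hlin : (fun N : ℕ ↦ y * (formCoeff 8 N : ℂ) + z * formCoeff 32 N) =
      y • qCoeffs (tunnellForm 8) + z • qCoeffs (tunnellForm 32) := by
    funext N
    simp only [Pi.add_apply, Pi.smul_apply, smul_eq_mul, qCoeffs_tunnellForm (by norm_num : 0 < 8),
      qCoeffs_tunnellForm (by norm_num : 0 < 32)]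
  have hz : z = 0 := by
    by_cases hp3 : p = 3
    · subst hp3
      have h0 := heckeTSq_three_eight hCO
      have e1 := congr_fun h 1
      have e9 := congr_fun h 9
      rw [h0, Pi.zero_apply] at e1 e9
      rw [formCoeff_eight_one, formCoeff_thirtytwo_one] at e1
      rw [formCoeff_eight_nine, formCoeff_thirtytwo_nine] at e9
      linear_combination (-e1 + e9) / 2
    · have hcop : Nat.Coprime p 3 := (Nat.coprime_primes hp Nat.prime_three).mpr hp3
      have hc := heckeTSq_comm 3 (1 : DirichletCharacter ℂ 128) hcop
      have e := congr_fun (LinearMap.congr_fun hc (qCoeffs (tunnellForm 8))) 1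
      simp only [LinearMap.coe_comp, Function.comp_apply] at e
      rw [heckeTSq_three_eight hCO, map_zero, Pi.zero_apply, h, hlin, map_add, map_smul, map_smul,
        heckeTSq_three_eight hCO, heckeTSq_three_thirtytwo hCO] at e
      simp only [smul_zero, zero_add, Pi.smul_apply, smul_eq_mul, formCoeff_eight_one,
        formCoeff_thirtytwo_one] at e
      linear_combination e / 2
  subst hz
  have hy : heckeTSq 3 (1 : DirichletCharacter ℂ 128) p (qCoeffs (tunnellForm 8)) 1 = y := by
    rw [h]
    simp [formCoeff_eight_one]
  rw [hy, h]
  funext N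
  simp [qCoeffs_tunnellForm (by norm_num : 0 < 8)]

/-- **Tunnell 1983, proof of Theorem 2 — `g(θ₂ - θ₈)` is an eigenform of every `T(p²)`, `p` odd,
given the basis**, the eigenvalue being half the coefficient of `q³` in `T(p²)(g(θ₂ - θ₈))`
(`a(3) = 2`): the image `x g θ₂ + y g θ₈ + z g θ₃₂ ∈ S_{3/2}(128, 1)` lives on `n ≡ 3 (mod 8)`, so
`x + y + z = 0` (`q¹`) and `x + y - z = 0` (`q⁹`), i.e. it is `x (g θ₂ - g θ₈)`.
[cite: Tunnell1983Congruent, proof of Thm 2, pp. 327–328] -/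
theorem heckeTSq_two_sub_eight_eq_smul {p : ℕ} (hp : p.Prime) (hp2 : p ≠ 2) :
    heckeTSq 3 (1 : DirichletCharacter ℂ 128) p (qCoeffs (tunnellForm 2 - tunnellForm 8)) =
      (
          heckeTSq 3 (1 : DirichletCharacter ℂ 128) p (qCoeffs (tunnellForm 2 - tunnellForm 8)) 3 / 2) •
        qCoeffs (tunnellForm 2 - tunnellForm 8) := by
  have hpo : Odd p := hp.odd_of_ne_two hp2
  obtain ⟨g, hgS, hg⟩ := (Shimura1973_heckeTSq_mem_holds 3 128 1 p ⟨1, rfl⟩ ⟨32, rfl⟩ hp).2 _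
    (Submodule.sub_mem _ tunnellForm_two_mem_halfIntCuspForms tunnellForm_eight_mem_halfIntCuspForms)
  obtain ⟨x, y, z, rfl⟩ := Submodule.mem_span_triple.mp (hCO hgS)
  rw [qCoeffs_lincomb_triv] at hg
  have hzero : ∀ {n : ℕ}, n % 8 ≠ 3 →
      heckeTSq 3 (1 : DirichletCharacter ℂ 128) p (qCoeffs (tunnellForm 2 - tunnellForm 8)) n = 0 := by
    intro n hn
    rw [qCoeffs_tunnellForm_two_sub_eight']
    exact heckeTSq_qCoeffs_tunnellForm_two_sub_eight_eq_zero (1 : DirichletCharacter ℂ 128) hpo hn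
  have h1 : x * (formCoeff 2 1 : ℂ) + y * formCoeff 8 1 + z * formCoeff 32 1 =
      heckeTSq 3 (1 : DirichletCharacter ℂ 128) p (qCoeffs (tunnellForm 2 - tunnellForm 8)) 1 := congr_fun hg 1
  have h9 : x * (formCoeff 2 9 : ℂ) + y * formCoeff 8 9 + z * formCoeff 32 9 =
      heckeTSq 3 (1 : DirichletCharacter ℂ 128) p (qCoeffs (tunnellForm 2 - tunnellForm 8)) 9 := congr_fun hg 9
  have h3 : x * (formCoeff 2 3 : ℂ) + y * formCoeff 8 3 + z * formCoeff 32 3 =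
      heckeTSq 3 (1 : DirichletCharacter ℂ 128) p (qCoeffs (tunnellForm 2 - tunnellForm 8)) 3 := congr_fun hg 3
  rw [hzero (by norm_num), formCoeff_two_one, formCoeff_eight_one, formCoeff_thirtytwo_one] at h1
  rw [hzero (by norm_num), formCoeff_two_nine, formCoeff_eight_nine, formCoeff_thirtytwo_nine] at h9
  have hz : z = 0 := by linear_combination (h1 - h9) / 2
  have hy : y = -x := by linear_combination (h1 + h9) / 2
  subst hz hy
  rw [formCoeff_two_three, formCoeff_eight_three, formCoeff_thirtytwo_three] at h3
  have hx :
      heckeTSq 3 (1 : DirichletCharacter ℂ 128) p (qCoeffs (tunnellForm 2 - tunnellForm 8)) 3 / 2 = x := by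
    rw [← h3]
    ring
  rw [hx, ← hg]
  funext N
  simp only [Pi.smul_apply, smul_eq_mul, qCoeffs_tunnellForm_two_sub_eight]
  ring

end Span

/-- `T(4)` kills `g θ₈` (`d₈(4n) = 0`): eigenvalue `0 = a₂(E)` for `T(2²)`. [folklore] -/
theorem heckeTSq_two_tunnellForm_eight :
    heckeTSq 3 (1 : DirichletCharacter ℂ 128) 2 (qCoeffs (tunnellForm 8)) = 0 := by
  funext n
  rw [heckeTSq_apply_of_dvd 3 (1 : DirichletCharacter ℂ 128) (by norm_num) ⟨64, rfl⟩, Pi.zero_apply]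
  exact qCoeffs_eight_eq_zero (by omega)

/-- `T(4)` kills `g θ₂ - g θ₈`. [folklore] -/
theorem heckeTSq_two_two_sub_eight :
    heckeTSq 3 (1 : DirichletCharacter ℂ 128) 2 (qCoeffs (tunnellForm 2 - tunnellForm 8)) = 0 := by
  funext n
  rw [heckeTSq_apply_of_dvd 3 (1 : DirichletCharacter ℂ 128) (by norm_num) ⟨64, rfl⟩, Pi.zero_apply]
  exact qCoeffs_two_sub_eight_eq_zero (by omega)

/-! ### "Consideration of `T(3²)`, `T(5²)`": the eigenvalues at `3` and `5` -/

/-- **`T(3²)(g θ₈)` has coefficient `0 = a₃(E)` at `q¹`**: `d₈(9) + (-1/3) d₈(1) = 1 - 1`.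
[cite: Tunnell1983Congruent, proof of Thm 2, p. 327] -/
theorem heckeTSq_tunnellForm_eight_three_one :
    heckeTSq 3 (1 : DirichletCharacter ℂ 128) 3 (qCoeffs (tunnellForm 8)) 1 = 0 := by
  rw [heckeTSq_three_apply, qCoeffs_tunnellForm (by norm_num : 0 < 8)]
  norm_num [formCoeff_eight_nine, formCoeff_eight_one, trivChar_three, trivChar_nine, Nat.dvd_one]

/-- **`T(5²)(g θ₈)` has coefficient `-2 = a₅(E)` at `q¹`**: `d₈(25) + (-1/5) d₈(1) = -3 + 1`.
[cite: Tunnell1983Congruent, proof of Thm 2, p. 327] -/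
theorem heckeTSq_tunnellForm_eight_five_one :
    heckeTSq 3 (1 : DirichletCharacter ℂ 128) 5 (qCoeffs (tunnellForm 8)) 1 = -2 := by
  rw [heckeTSq_three_apply, qCoeffs_tunnellForm (by norm_num : 0 < 8)]
  norm_num [formCoeff_eight_twentyfive, formCoeff_eight_one, trivChar_five, trivChar_twentyfive, Nat.dvd_one]

/-- **`T(3²)(g θ₂ - g θ₈)` has coefficient `0 = 2 a₃(E)` at `q³`**: `(d₂ - d₈)(27) + (-3/3) · 2 = 0 + 0`.
[cite: Tunnell1983Congruent, proof of Thm 2, p. 327] -/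
theorem heckeTSq_two_sub_eight_three_three :
    heckeTSq 3 (1 : DirichletCharacter ℂ 128) 3 (qCoeffs (tunnellForm 2 - tunnellForm 8)) 3 = 0 := by
  rw [heckeTSq_three_apply, qCoeffs_tunnellForm_two_sub_eight]
  have h27 : (formCoeff 8 27 : ℂ) = 0 := by rw [formCoeff_eight_eq_zero (by norm_num), Int.cast_zero]
  norm_num [formCoeff_two_twentyseven, h27, formCoeff_two_three, formCoeff_eight_three, trivChar_three,
    trivChar_nine]

/-- **`T(5²)(g θ₂ - g θ₈)` has coefficient `-4 = 2 a₅(E)` at `q³`**: `(d₂ - d₈)(75) + (-3/5) · 2 = -2 - 2`.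
[cite: Tunnell1983Congruent, proof of Thm 2, p. 327] -/
theorem heckeTSq_two_sub_eight_five_three :
    heckeTSq 3 (1 : DirichletCharacter ℂ 128) 5 (qCoeffs (tunnellForm 2 - tunnellForm 8)) 3 = -4 := by
  rw [heckeTSq_three_apply, qCoeffs_tunnellForm_two_sub_eight]
  have h75 : (formCoeff 8 75 : ℂ) = 0 := by rw [formCoeff_eight_eq_zero (by norm_num), Int.cast_zero]
  norm_num [formCoeff_two_seventyfive, h75, formCoeff_two_three, formCoeff_eight_three, trivChar_five,
    trivChar_twentyfive]

/-! ### Theorem 2 (trivial character) from the dimension count and the Shimura–Niwa correspondence -/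

/-- `g θ₈ ≠ 0` (its coefficient of `q¹` is `1`). [folklore] -/
theorem tunnellForm_eight_ne_zero : tunnellForm 8 ≠ 0 := by
  intro h
  have h1 := congr_fun (qCoeffs_tunnellForm (by norm_num : 0 < 8)) 1
  rw [h, qCoeffs_zero, Pi.zero_apply, formCoeff_eight_one] at h1
  exact zero_ne_one h1

/-- `g θ₂ - g θ₈ ≠ 0` (its coefficient of `q³` is `2`). [folklore] -/
theorem tunnellForm_two_sub_eight_ne_zero : tunnellForm 2 - tunnellForm 8 ≠ 0 := by
  intro h
  have h3 := congr_fun qCoeffs_tunnellForm_two_sub_eight 3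
  rw [h, qCoeffs_zero, Pi.zero_apply, formCoeff_two_three, formCoeff_eight_three] at h3
  norm_num at h3

/-- **Tunnell 1983, Theorem 2 (trivial character) from its two external inputs.** With (M)
`g θ₂, g θ₈, g θ₃₂ ∈ S_{3/2}(128, 1)` now theorems (`tunnellForm_*_mem_halfIntCuspForms`), assume
(CO) `S_{3/2}(128, 1) ⊆ span {g θ₂, g θ₈, g θ₃₂}` (the dimension count of Cohen–Oesterlé [3] behind
"`{g θ₂, g θ₈, g θ₃₂}` is a basis", p. 327), and (SN) every nonzero common eigenform of the `T(p²)`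
(`p` prime) in `S_{3/2}(128, 1)` whose `T(3²)`- and `T(5²)`-eigenvalues are `0` and `-2` has
`T(p²)`-eigenvalue `a_p(E)` for every odd prime `p` (Shimura's theorem [18] with Niwa [11] and the
table of weight-`2` forms of level dividing `128` [4, Table 3]: "Consideration of `T(3²)` and
`T(5²)` shows that `φ₁ = φ₂ = φ`", p. 328). Then `g θ₂` and `g θ₈` lie in `S_{3/2}(128, 1, φ)`: by
`heckeTSq_tunnellForm_eight_eq_smul`, `heckeTSq_two_sub_eight_eq_smul` and `T(4) = 0` on them,
`g θ₈` and `g(θ₂ - θ₈)` are common eigenforms with `λ₃ = 0`, `λ₅ = -2`, so (SN) gives the eigenvalues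
`a_p(E)` for all odd `p`, and `g θ₂ = g(θ₂ - θ₈) + g θ₈`.
[cite: Tunnell1983Congruent, Thm 2 and its proof, pp. 327–328] -/
theorem Tunnell1983_thm2_triv_of_span_of_shimuraNiwa
    (hCO : halfIntCuspForms 3 128 1 ≤
      Submodule.span ℂ {tunnellForm 2, tunnellForm 8, tunnellForm 32})
    (hSN : ∀ f ∈ halfIntCuspForms 3 128 1, f ≠ 0 → ∀ ev : ℕ → ℂ,
      (∀ p : ℕ, p.Prime →
          heckeTSq 3 (1 : DirichletCharacter ℂ 128) p (qCoeffs f) = ev p • qCoeffs f) →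
      ev 3 = 0 → ev 5 = -2 → ∀ p : ℕ, p.Prime → p ≠ 2 → ev p = tunnellEigenvalues p) :
    Tunnell1983_thm2_triv := by
  have hM8 := tunnellForm_eight_mem_halfIntCuspForms
  have hM2 := tunnellForm_two_mem_halfIntCuspForms
  -- `F₁ = g θ₈`
  set ev₁ : ℕ → ℂ := fun p ↦ if p = 2 then 0 else
      heckeTSq 3 (1 : DirichletCharacter ℂ 128) p (qCoeffs (tunnellForm 8)) 1
    with hev₁
  have hE₁ : ∀ p : ℕ, p.Prime →
      heckeTSq 3 (1 : DirichletCharacter ℂ 128) p (qCoeffs (tunnellForm 8)) =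
      ev₁ p • qCoeffs (tunnellForm 8) := by
    intro p hp
    by_cases hp2 : p = 2
    · subst hp2
      rw [heckeTSq_two_tunnellForm_eight, hev₁]
      simp
    · rw [hev₁]
      simp only [hp2, if_false]
      exact heckeTSq_tunnellForm_eight_eq_smul hCO hp hp2
  have h3₁ : ev₁ 3 = 0 := by
    rw [hev₁]
    simp only [show (3 : ℕ) ≠ 2 by norm_num, if_false]
    exact heckeTSq_tunnellForm_eight_three_one
  have h5₁ : ev₁ 5 = -2 := by
    rw [hev₁]
    simp only [show (5 : ℕ) ≠ 2 by norm_num, if_false]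
    exact heckeTSq_tunnellForm_eight_five_one
  have hl₁ := hSN _ hM8 tunnellForm_eight_ne_zero ev₁ hE₁ h3₁ h5₁
  have hA₁ : IsAlmostEigenform 3 128 1 tunnellEigenvalues (tunnellForm 8) :=
    isAlmostEigenform_of_forall fun p hp hpN ↦ by
      rw [hE₁ p hp, hl₁ p hp (ne_two_of_not_dvd hpN)]
  have hmem₁ : tunnellForm 8 ∈ tunnellSubspace 1 := mem_shimuraSubspace_of_isAlmostEigenform hM8 hA₁
  -- `F₃ = g θ₂ - g θ₈`
  have hM3 : tunnellForm 2 - tunnellForm 8 ∈ halfIntCuspForms 3 128 1 := Submodule.sub_mem _ hM2 hM8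
  set ev₃ : ℕ → ℂ := fun p ↦ if p = 2 then 0 else
      heckeTSq 3 (1 : DirichletCharacter ℂ 128) p (qCoeffs (tunnellForm 2 - tunnellForm 8)) 3 / 2 with hev₃
  have hE₃ : ∀ p : ℕ, p.Prime →
      heckeTSq 3 (1 : DirichletCharacter ℂ 128) p (qCoeffs (tunnellForm 2 - tunnellForm 8)) =
      ev₃ p • qCoeffs (tunnellForm 2 - tunnellForm 8) := by
    intro p hp
    by_cases hp2 : p = 2
    · subst hp2
      rw [heckeTSq_two_two_sub_eight, hev₃]
      simp
    · rw [hev₃]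
      simp only [hp2, if_false]
      exact heckeTSq_two_sub_eight_eq_smul hCO hp hp2
  have h3₃ : ev₃ 3 = 0 := by
    rw [hev₃]
    simp only [show (3 : ℕ) ≠ 2 by norm_num, if_false]
    rw [heckeTSq_two_sub_eight_three_three]
    simp
  have h5₃ : ev₃ 5 = -2 := by
    rw [hev₃]
    simp only [show (5 : ℕ) ≠ 2 by norm_num, if_false]
    rw [heckeTSq_two_sub_eight_five_three]
    norm_num
  have hl₃ := hSN _ hM3 tunnellForm_two_sub_eight_ne_zero ev₃ hE₃ h3₃ h5₃
  have hA₃ : IsAlmostEigenform 3 128 1 tunnellEigenvalues (tunnellForm 2 - tunnellForm 8) :=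
    isAlmostEigenform_of_forall fun p hp hpN ↦ by
      rw [hE₃ p hp, hl₃ p hp (ne_two_of_not_dvd hpN)]
  have hmem₃ : tunnellForm 2 - tunnellForm 8 ∈ tunnellSubspace 1 :=
    mem_shimuraSubspace_of_isAlmostEigenform hM3 hA₃
  have hmem₂ : tunnellForm 2 ∈ tunnellSubspace 1 := by
    have := Submodule.add_mem _ hmem₃ hmem₁
    simpa using this
  exact ⟨hmem₂, hmem₁⟩

/-! ### The dimension form of (CO): `dim S_{3/2}(128, 1) ≤ 3` suffices -/

/-- **`g θ₂, g θ₈, g θ₃₂` are linearly independent** (the easy half of "`{g θ₂, g θ₈, g θ₃₂}` is a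
basis", p. 327): compare the coefficients of `q³` (`2x`), `q¹` (`x + y + z`) and `q⁹` (`x + y - z`)
of `x g θ₂ + y g θ₈ + z g θ₃₂`. [cite: Tunnell1983Congruent, p. 327, ll. 17–19] -/
theorem linearIndependent_tunnellForm_triv :
    LinearIndependent ℂ ![tunnellForm 2, tunnellForm 8, tunnellForm 32] := by
  rw [Fintype.linearIndependent_iff]
  intro c hc i
  have hsum : ∑ j, c j • (![tunnellForm 2, tunnellForm 8, tunnellForm 32] j) =
      c 0 • tunnellForm 2 + c 1 • tunnellForm 8 + c 2 • tunnellForm 32 := by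
    simp only [Fin.sum_univ_three, Matrix.cons_val_zero, Matrix.cons_val_one, Matrix.cons_val]
  rw [hsum] at hc
  have hq := qCoeffs_lincomb_triv (c 0) (c 1) (c 2)
  rw [hc, qCoeffs_zero] at hq
  have h3 := congr_fun hq 3
  have h1 := congr_fun hq 1
  have h9 := congr_fun hq 9
  simp only [Pi.zero_apply] at h1 h3 h9
  rw [formCoeff_two_three, formCoeff_eight_three, formCoeff_thirtytwo_three] at h3
  rw [formCoeff_two_one, formCoeff_eight_one, formCoeff_thirtytwo_one] at h1
  rw [formCoeff_two_nine, formCoeff_eight_nine, formCoeff_thirtytwo_nine] at h9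
  have e0 : c 0 = 0 := by linear_combination -h3 / 2
  have e1 : c 1 = 0 := by linear_combination (-(h1) - h9) / 2 - e0
  have e2 : c 2 = 0 := by linear_combination (h9 - h1) / 2
  fin_cases i
  · exact e0
  · exact e1
  · exact e2

/-- **(CO) from the dimension count**: if `S_{3/2}(128, 1)` is finite-dimensional of dimension
`≤ 3` (Cohen–Oesterlé [3]: `= 3`), then it is spanned by `g θ₂, g θ₈, g θ₃₂` (which lie in it and
are linearly independent). [cite: Tunnell1983Congruent, p. 327, ll. 17–19] -/
theorem halfIntCuspForms_le_span_of_finrank_le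
    [FiniteDimensional ℂ (halfIntCuspForms 3 128 (1 : DirichletCharacter ℂ 128))]
    (hdim : Module.finrank ℂ (halfIntCuspForms 3 128 (1 : DirichletCharacter ℂ 128)) ≤ 3) :
    halfIntCuspForms 3 128 1 ≤ Submodule.span ℂ {tunnellForm 2, tunnellForm 8, tunnellForm 32} := by
  have hli := linearIndependent_tunnellForm_triv
  have hrange : Set.range ![tunnellForm 2, tunnellForm 8, tunnellForm 32] =
      {tunnellForm 2, tunnellForm 8, tunnellForm 32} := by
    rw [Matrix.range_cons, Matrix.range_cons, Matrix.range_cons, Matrix.range_empty,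
      Set.union_empty]
    ext f
    simp only [Set.mem_union, Set.mem_singleton_iff, Set.mem_insert_iff]
  have hle : Submodule.span ℂ {tunnellForm 2, tunnellForm 8, tunnellForm 32} ≤
      halfIntCuspForms 3 128 1 := by
    rw [Submodule.span_le]
    intro f hf
    simp only [Set.mem_insert_iff, Set.mem_singleton_iff] at hf
    rcases hf with rfl | rfl | rfl
    · exact tunnellForm_two_mem_halfIntCuspForms
    · exact tunnellForm_eight_mem_halfIntCuspForms
    · exact tunnellForm_thirtytwo_mem_halfIntCuspForms
  have hfr : Module.finrank ℂ
      (Submodule.span ℂ ({tunnellForm 2, tunnellForm 8, tunnellForm 32} : Set (ℍ → ℂ))) = 3 := by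
    rw [← hrange, finrank_span_eq_card hli, Fintype.card_fin]
  have heq := Submodule.eq_of_le_of_finrank_le hle (by rw [hfr]; exact hdim)
  exact heq ▸ le_rfl

/-- **Tunnell 1983, Theorem 2 (trivial character) from the dimension count and (SN)**: the form in
which the first external input is literally the dimension formula `dim S_{3/2}(128, 1) = 3` of
Cohen–Oesterlé [3] (only `≤ 3` and finite-dimensionality are used).
[cite: Tunnell1983Congruent, Thm 2 and its proof, pp. 327–328] -/
theorem Tunnell1983_thm2_triv_of_finrank_le_of_shimuraNiwa
    [FiniteDimensional ℂ (halfIntCuspForms 3 128 (1 : DirichletCharacter ℂ 128))]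
    (hdim : Module.finrank ℂ (halfIntCuspForms 3 128 (1 : DirichletCharacter ℂ 128)) ≤ 3)
    (hSN : ∀ f ∈ halfIntCuspForms 3 128 1, f ≠ 0 → ∀ ev : ℕ → ℂ,
      (∀ p : ℕ, p.Prime →
        heckeTSq 3 (1 : DirichletCharacter ℂ 128) p (qCoeffs f) = ev p • qCoeffs f) →
      ev 3 = 0 → ev 5 = -2 → ∀ p : ℕ, p.Prime → p ≠ 2 → ev p = tunnellEigenvalues p) :
    Tunnell1983_thm2_triv :=
  Tunnell1983_thm2_triv_of_span_of_shimuraNiwa (halfIntCuspForms_le_span_of_finrank_le hdim) hSN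

end Literature.NumberTheory.EllipticCurves.Tunnell1983
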